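import Literature.MathematicalPhysics.QuantumLattice.YangMillsHeatFlowProofs
import Literature.Analysis.Calculus.TangentialForms
import HarnessLib

/-!
# The tangential part of the curvature on spheres and its covariant derivative

QuantumLattice support file (everything proved; one definition, no named facts) on the proof
path of `Literature.MathematicalPhysics.QuantumLattice.Waldron2019_yangMillsFlow_flatTorus`
(A. Waldron, Invent. math. 217 (2019)), §4.2: in Waldron's split `F = ds ∧ Φ + Ω` on
`B₁ ∖ {0} ≃ ℝ₋ × S³` the tangential 2-form is, extrinsically, `Ω_y(a, c) = F_y(P_y a, P_y c)` and the
radial contraction is `Φ_y(c) = F_y(y, P_y c)` (`P` = `tangentialProj`, `RadialCalculus`). The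
sphere ("Levi-Civita ⊗ A") covariant derivative of `Ω` with arguments frozen at `x` is the ambient
covariant derivative of the field `y ↦ F_y(P_y a, P_y c)`; by the Leibniz rule through `P`
(`TangentialForms`) it equals the ambient `D_uF(a, c)` plus the Gauss–Codazzi coupling to `Φ`:

* `curvatureCLM A y : E →L E →L 𝔸`, `curvatureCLM_apply` — the curvature as a continuous
  bilinear map (`DA(y) − DA(y)ᵀ + [A(y)·, A(y)·]`), and its differentiability for `A ∈ C²`;
* `covDeriv_curvature_tangential_apply` — for `x ≠ 0`, tangential frozen `a, c ⊥ x` and any `u`: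
  `D_u(y ↦ F_y(P_y a, P_y c))(x) = D_uF(x)(a, c) − (⟨P_xu, a⟩/‖x‖²) F_x(x, c) − (⟨P_xu, c⟩/‖x‖²) F_x(a, x)`.

References: A. Waldron, Invent. math. 217 (2019), §4.2 (the split `F = ds∧Φ + Ω`, (4.5)–(4.6))
[Waldron2019].
-/

noncomputable section

open scoped RealInnerProductSpace Topology
open Literature.Analysis.Calculus

namespace Literature.MathematicalPhysics.QuantumLattice

section TangentialCurvature

variable {E : Type*} [NormedAddCommGroup E] [InnerProductSpace ℝ E]
variable {𝔸 : Type*} [NormedRing 𝔸] [NormedAlgebra ℝ 𝔸]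

/-- **The curvature as a continuous bilinear map**: `F(y) = DA(y) − DA(y)ᵀ + [A(y)·, A(y)·]`.
[folklore] -/
def curvatureCLM (A : Connection E 𝔸) (y : E) : E →L[ℝ] E →L[ℝ] 𝔸 :=
  fderiv ℝ A y - (fderiv ℝ A y).flip +
    ((((ContinuousLinearMap.compL ℝ E 𝔸 𝔸).flip (A y)).comp
        ((ContinuousLinearMap.mul ℝ 𝔸).comp (A y))) -
      (((ContinuousLinearMap.compL ℝ E 𝔸 𝔸).flip (A y)).comp
        ((ContinuousLinearMap.mul ℝ 𝔸).flip.comp (A y))))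

/-- `curvatureCLM A y u v = F_A(y)(u, v)` for `A` differentiable at `y`. [folklore] -/
theorem curvatureCLM_apply {A : Connection E 𝔸} {y : E} (hA : DifferentiableAt ℝ A y) (u v : E) :
    curvatureCLM A y u v = curvature A y u v := by
  have h1 : fderiv ℝ (fun z => A z v) y u = fderiv ℝ A y u v := by
    rw [fderiv_clm_apply hA (differentiableAt_const v)]; simp
  have h2 : fderiv ℝ (fun z => A z u) y v = fderiv ℝ A y v u := by
    rw [fderiv_clm_apply hA (differentiableAt_const u)]; simp
  simp [curvatureCLM, curvature, h1, h2, Ring.lie_def]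

/-- Differentiability of `y ↦ curvatureCLM A y` for `A ∈ C²`. [folklore] -/
theorem differentiableAt_curvatureCLM {A : Connection E 𝔸} (hA : ContDiff ℝ 2 A) (y : E) :
    DifferentiableAt ℝ (curvatureCLM A) y := by
  have hAd : Differentiable ℝ A := hA.differentiable two_ne_zero
  have hA2 : Differentiable ℝ (fderiv ℝ A) :=
    (hA.fderiv_right (m := 1) (by norm_num)).differentiable one_ne_zero
  have h1 : DifferentiableAt ℝ (fun z => fderiv ℝ A z) y := hA2 y
  have h2 : DifferentiableAt ℝ (fun z => (fderiv ℝ A z).flip) y := by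
    have h := DifferentiableAt.clm_apply (𝕜 := ℝ) (G := E →L[ℝ] E →L[ℝ] 𝔸) (H := E →L[ℝ] E →L[ℝ] 𝔸)
      (c := fun _ : E => ((ContinuousLinearMap.flipₗᵢ ℝ E E 𝔸).toContinuousLinearEquiv :
        (E →L[ℝ] E →L[ℝ] 𝔸) →L[ℝ] (E →L[ℝ] E →L[ℝ] 𝔸)))
      (u := fderiv ℝ A) (differentiableAt_const _) (hA2 y)
    exact h
  have hc1 : DifferentiableAt ℝ (fun z => (ContinuousLinearMap.compL ℝ E 𝔸 𝔸).flip (A z)) y :=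
    DifferentiableAt.clm_apply (𝕜 := ℝ) (G := E →L[ℝ] 𝔸) (H := (𝔸 →L[ℝ] 𝔸) →L[ℝ] E →L[ℝ] 𝔸)
      (c := fun _ : E => (ContinuousLinearMap.compL ℝ E 𝔸 𝔸).flip) (u := A)
      (differentiableAt_const _) (hAd y)
  have hc2 : DifferentiableAt ℝ (fun z => (ContinuousLinearMap.mul ℝ 𝔸).comp (A z)) y :=
    (differentiableAt_const _).clm_comp (hAd y)
  have hc3 : DifferentiableAt ℝ (fun z => (ContinuousLinearMap.mul ℝ 𝔸).flip.comp (A z)) y :=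
    (differentiableAt_const _).clm_comp (hAd y)
  have h3 := hc1.clm_comp hc2
  have h4 := hc1.clm_comp hc3
  exact DifferentiableAt.add (𝕜 := ℝ) (F := E →L[ℝ] E →L[ℝ] 𝔸)
    (DifferentiableAt.sub (𝕜 := ℝ) (F := E →L[ℝ] E →L[ℝ] 𝔸) h1 h2)
    (DifferentiableAt.sub (𝕜 := ℝ) (F := E →L[ℝ] E →L[ℝ] 𝔸) h3 h4)

/-- **The sphere covariant derivative of the tangential curvature, extrinsically.** For a `C²`
connection `A`, `x ≠ 0`, frozen tangential arguments `a, c ⊥ x` and any direction `u`: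
`D_u(y ↦ F_y(P_y a, P_y c))(x) = D_uF(x)(a, c) − (⟨P_x u, a⟩/‖x‖²) F_x(x, c) − (⟨P_x u, c⟩/‖x‖²) F_x(a, x)`
— the tangential derivative of `Ω = F(P·,P·)` is the ambient `DF` plus the coupling to the radial
part `Φ = F(x, P·)` (Waldron's `∂ₛΩ = d_θΦ`-type terms). [cite: Waldron2019, §4.2] -/
theorem covDeriv_curvature_tangential_apply {A : Connection E 𝔸} (hA : ContDiff ℝ 2 A) {x : E}
    (hx : x ≠ 0) {a c : E} (ha : ⟪x, a⟫ = 0) (hc : ⟪x, c⟫ = 0) (u : E) :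
    covDeriv A (fun y => curvature A y (tangentialProj y a) (tangentialProj y c)) x u =
      covDeriv A (fun y => curvature A y a c) x u -
        ((‖x‖ ^ 2)⁻¹ * ⟪tangentialProj x u, a⟫) • curvature A x x c -
        ((‖x‖ ^ 2)⁻¹ * ⟪tangentialProj x u, c⟫) • curvature A x a x := by
  have hAd : Differentiable ℝ A := hA.differentiable two_ne_zero
  have hB := differentiableAt_curvatureCLM hA x
  -- replace `curvature` by the bilinear map `curvatureCLM` inside both sections
  have heq1 : (fun y => curvature A y (tangentialProj y a) (tangentialProj y c)) =
      fun y => curvatureCLM A y (tangentialProj y a) (tangentialProj y c) :=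
    funext fun y => (curvatureCLM_apply (hAd y) _ _).symm
  have heq2 : (fun y => curvature A y a c) = fun y => curvatureCLM A y a c :=
    funext fun y => (curvatureCLM_apply (hAd y) _ _).symm
  rw [heq1, heq2]
  unfold covDeriv
  rw [fderiv_bilinear_tangentialProj_apply_of_tangential hB hx ha hc u,
    fderiv_clm_apply (hB.clm_apply (differentiableAt_const a)) (differentiableAt_const c),
    fderiv_clm_apply hB (differentiableAt_const a)]
  simp only [fderiv_const_apply, zero_apply, map_zero, zero_add,
    ContinuousLinearMap.comp_apply, ContinuousLinearMap.flip_apply, FunLike.coe_add, Pi.add_apply,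
    tangentialProj_eq_self ha, tangentialProj_eq_self hc]
  simp only [curvatureCLM_apply (hAd x)]
  abel

end TangentialCurvature

end Literature.MathematicalPhysics.QuantumLattice
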